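import Mathlib
import HarnessLib

/-!
# `FemtoCurvatureSkewness` — stub `DominanceFromCoupling` of line `Sketch-ideator3`
(crux stmt-QuantumFields-9365)

Elementary real analysis: relative error `1/8` on a signed quantity `kP ≈ kQ` and on three
positive quantities `aᵢ ≈ bᵢ`, with the permanental identity `kQ² = (8/d)·b₁b₂b₃`, gives
`| |kP| − √8/√d·√(a₁a₂a₃) | ≤ ½ · √8/√d·√(a₁a₂a₃)`.

Proof: `aᵢ ∈ [7bᵢ/8, 9bᵢ/8]`, hence `(7/8)³ b₁b₂b₃ ≤ a₁a₂a₃ ≤ (9/8)³ b₁b₂b₃`;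
`|kP| ∈ [7|kQ|/8, 9|kQ|/8]`; with `p := √8/√d·√(a₁a₂a₃)` one has `p² = (8/d)·a₁a₂a₃` and
`|kQ|² = (8/d)·b₁b₂b₃`, so comparing squares `(p/2)² ≤ |kP|² ≤ (3p/2)²`, whence
`p/2 ≤ |kP| ≤ 3p/2`.
-/

noncomputable section

namespace Summit.QuantumFields.YangMills.Theorems.FemtoCurvatureSkewness

/-- Square-comparison core of `DominanceFromCoupling` on abstract reals: if `x ∈ [7q/8, 9q/8]`,
`q² = c·Pb`, `p² = c·Pa` with `c, p, q, x ≥ 0` and `(7/8)³ Pb ≤ Pa ≤ (9/8)³ Pb`, then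
`|x - p| ≤ p/2`. -/
private theorem dominanceFromCoupling_sq_aux {x q p c Pa Pb : ℝ} (hx0 : 0 ≤ x) (hq0 : 0 ≤ q)
    (hp0 : 0 ≤ p) (hc : 0 ≤ c) (hq2 : q ^ 2 = c * Pb) (hp2 : p ^ 2 = c * Pa)
    (hPl : 343 / 512 * Pb ≤ Pa) (hPu : Pa ≤ 729 / 512 * Pb)
    (hku : x ≤ 9 / 8 * q) (hkl : 7 / 8 * q ≤ x) :
    |x - p| ≤ 1 / 2 * p := by
  -- transport the product comparison through the nonnegative factor `c`
  have hcl : c * (343 / 512 * Pb) ≤ c * Pa := mul_le_mul_of_nonneg_left hPl hc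
  have hcu : c * Pa ≤ c * (729 / 512 * Pb) := mul_le_mul_of_nonneg_left hPu hc
  rw [abs_sub_le_iff]
  constructor
  · -- upper bound `x ≤ 3p/2`, via `x² ≤ (9q/8)² ≤ (3p/2)²`
    have h1 : x ^ 2 ≤ (9 / 8 * q) ^ 2 := pow_le_pow_left₀ hx0 hku 2
    have hsq : x ^ 2 ≤ (3 / 2 * p) ^ 2 := by nlinarith [h1, hq2, hp2, hcl, sq_nonneg p]
    have h2 : x ≤ 3 / 2 * p := (sq_le_sq₀ hx0 (by positivity)).1 hsq
    linarith only [h2]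
  · -- lower bound `p/2 ≤ x`, via `(p/2)² ≤ (7q/8)² ≤ x²`
    have h1 : (7 / 8 * q) ^ 2 ≤ x ^ 2 := pow_le_pow_left₀ (by positivity) hkl 2
    have hsq : (1 / 2 * p) ^ 2 ≤ x ^ 2 := by nlinarith [h1, hq2, hp2, hcu, sq_nonneg p]
    have h2 : 1 / 2 * p ≤ x := (sq_le_sq₀ (by positivity) hx0).1 hsq
    linarith only [h2]

/-- **Dominance from coupling** (stub `DominanceFromCoupling`, registered signature verbatim):
if `kP` is within relative error `1/8` of `kQ`, each `aᵢ` is within relative error `1/8` of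
`bᵢ > 0`, and `kQ² = (8/d)·b₁b₂b₃`, then `|kP|` is within relative error `1/2` of
`√8/√d·√(a₁a₂a₃)`. -/
theorem DominanceFromCoupling :
  ∀ (d kP kQ a₁ a₂ a₃ b₁ b₂ b₃ : ℝ), 0 < d → 0 < b₁ → 0 < b₂ → 0 < b₃ →
    kQ ^ 2 = 8 / d * (b₁ * b₂ * b₃) →
    |kP - kQ| ≤ |kQ| / 8 → |a₁ - b₁| ≤ b₁ / 8 → |a₂ - b₂| ≤ b₂ / 8 → |a₃ - b₃| ≤ b₃ / 8 →
    |(|kP|) - Real.sqrt 8 / Real.sqrt d * Real.sqrt (a₁ * a₂ * a₃)| ≤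
      1 / 2 * (Real.sqrt 8 / Real.sqrt d * Real.sqrt (a₁ * a₂ * a₃)) := by
  intro d kP kQ a₁ a₂ a₃ b₁ b₂ b₃ hd hb₁ hb₂ hb₃ hW hk h₁ h₂ h₃
  -- the three positive quantities lie within relative error `1/8` of the reference ones
  obtain ⟨h₁u, h₁l⟩ := abs_sub_le_iff.mp h₁
  obtain ⟨h₂u, h₂l⟩ := abs_sub_le_iff.mp h₂
  obtain ⟨h₃u, h₃l⟩ := abs_sub_le_iff.mp h₃
  have hl₁ : 7 / 8 * b₁ ≤ a₁ := by linarith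
  have hl₂ : 7 / 8 * b₂ ≤ a₂ := by linarith
  have hl₃ : 7 / 8 * b₃ ≤ a₃ := by linarith
  have hu₁ : a₁ ≤ 9 / 8 * b₁ := by linarith
  have hu₂ : a₂ ≤ 9 / 8 * b₂ := by linarith
  have hu₃ : a₃ ≤ 9 / 8 * b₃ := by linarith
  have ha₁ : 0 < a₁ := by linarith
  have ha₂ : 0 < a₂ := by linarith
  have ha₃ : 0 < a₃ := by linarith
  -- the two triple products are comparable up to the factors `(7/8)³` and `(9/8)³`
  have hPl : 7 / 8 * b₁ * (7 / 8 * b₂) * (7 / 8 * b₃) ≤ a₁ * a₂ * a₃ :=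
    mul_le_mul (mul_le_mul hl₁ hl₂ (by positivity) ha₁.le) hl₃ (by positivity)
      (by positivity)
  have hPu : a₁ * a₂ * a₃ ≤ 9 / 8 * b₁ * (9 / 8 * b₂) * (9 / 8 * b₃) :=
    mul_le_mul (mul_le_mul hu₁ hu₂ ha₂.le (by positivity)) hu₃ ha₃.le (by positivity)
  have hPl' : 343 / 512 * (b₁ * b₂ * b₃) ≤ a₁ * a₂ * a₃ := by linarith
  have hPu' : a₁ * a₂ * a₃ ≤ 729 / 512 * (b₁ * b₂ * b₃) := by linarith
  -- the signed quantity: `| |kP| - |kQ| | ≤ |kQ| / 8`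
  have hk' : |(|kP|) - (|kQ|)| ≤ |kQ| / 8 := (abs_abs_sub_abs_le_abs_sub kP kQ).trans hk
  obtain ⟨hku, hkl⟩ := abs_sub_le_iff.mp hk'
  have hku' : |kP| ≤ 9 / 8 * |kQ| := by linarith
  have hkl' : 7 / 8 * |kQ| ≤ |kP| := by linarith
  -- squares of the reference quantity and of the prediction
  have hc : (0 : ℝ) ≤ 8 / d := by positivity
  have hq2 : |kQ| ^ 2 = 8 / d * (b₁ * b₂ * b₃) := (sq_abs kQ).trans hW
  have hp0 : 0 ≤ Real.sqrt 8 / Real.sqrt d * Real.sqrt (a₁ * a₂ * a₃) := by positivity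
  have hp2 :
      (Real.sqrt 8 / Real.sqrt d * Real.sqrt (a₁ * a₂ * a₃)) ^ 2 = 8 / d * (a₁ * a₂ * a₃) := by
    rw [mul_pow, div_pow, Real.sq_sqrt (by norm_num : (0 : ℝ) ≤ 8), Real.sq_sqrt hd.le,
      Real.sq_sqrt (by positivity)]
  exact dominanceFromCoupling_sq_aux (abs_nonneg kP) (abs_nonneg kQ) hp0 hc hq2 hp2 hPl' hPu'
    hku' hkl'

end Summit.QuantumFields.YangMills.Theorems.FemtoCurvatureSkewness

end
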